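import Literature.Topology.FourManifolds.Cobordism
import Literature.Geometry.Lorentzian.PseudoRiemannianMetric
import Literature.Geometry.Lorentzian.LeviCivita
import Literature.Geometry.Lorentzian.Isometry
import HarnessLib

/-!
# Every boundary metric extends to a positive scalar curvature metric inside (Shi–Wang–Wei)

Topic `Literature/Geometry/Riemannian`; fact request `wi-17843` (route
SmoothPoincare4/PscCorkFillIn, support item `FlexBoundaryMetric`, ledger item
`stmt-SmoothPoincare4-8133`).

**Shi–Wang–Wei 2022, Thm 1.1** (answering Gromov, *Four lectures*, Question pp. 31–32): "Let
`X` be a compact manifold with non-empty boundary `Y = ∂X`. Then any metric `γ` on `Y` can be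
extended to a Riemannian metric `g` on `X` with positive scalar curvature." Here, as throughout
the paper, a *manifold* `X` is connected (only the boundary `Y` may have several components:
proof of Thm 1.1, last paragraph, p. 7); see "Connectedness" below. (Remark 2.1, not vendored:
any mean curvature `H ≤ C(X, γ)` can moreover be prescribed.)

## Content

* NAMED FACT `ShiWangWei2022_boundaryMetric_extends_psc` — the theorem for compact CONNECTED
  smooth manifolds with boundary of dimension `m + 3 ≥ 3` (the paper's setting: boundaries `Σⁿ`,
  `n ≥ 2`), over the tree's vocabulary: `X` charted on `EuclideanHalfSpace (m+3)` with model
  `𝓡∂ (m+3)`, `[CompactSpace X] [ConnectedSpace X]`, its boundary presented by a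
  `Literature.Topology.FourManifolds.BoundaryData` datum `bX` (a smooth embedding `bX.incl` of an
  `(m+2)`-manifold onto `∂X`), NON-EMPTY; metrics are
  `Literature.Geometry.Lorentzian.PseudoRiemannianMetric` on the tangent bundles, "Riemannian" is
  `IsRiemannian`, the scalar curvature is `scalarCurvature` (which presupposes a Levi-Civita
  connection, packaged as `∃ _ : g.HasLeviCivita` — mathematically automatic), and "extends `γ`"
  is `bX.incl^* g = γ` (`pullbackBilin`).
* PROVED corollary `….flexBoundaryMetric_four`: the dimension-4 form for CONNECTED `C` — on a
  compact connected 4-manifold with boundary admitting SOME positive scalar curvature metric (a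
  hypothesis that replaces non-emptiness of the boundary: when the boundary is empty it supplies
  the metric, when it is non-empty the theorem applies), every Riemannian metric on the boundary
  is the induced boundary form of a Riemannian PSC metric. This is the statement of item
  `FlexBoundaryMetric` (`stmt-SmoothPoincare4-8133`) with `[ConnectedSpace C]` ADDED; see
  "Relation to the route item" below.

## Connectedness (correction history, D-0026 review 2026-08-15)

The first rendering of this fact (gen 1, p43130) quantified over ALL compact `X` with
`Nonempty ∂X` and was FALSE: for `X = T³ ⊔ 𝔻³` (`m = 0`; compact, smooth, `∂X = S² ≠ ∅`) a metric
of positive scalar curvature on `X` would restrict to one on the closed component `T³`, which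
carries none (Schoen–Yau, Manuscripta Math. 28 (1979); Gromov–Lawson, Ann. of Math. 111 (1980); in
dimension `m + 3` use `T^{m+3} ⊔ 𝔻^{m+3}`) — the paper itself uses exactly this in its Example 2.1
("we can get a smooth PSC metric on `T³`, which is a contradiction", citing [SY79MM]). The paper
works with connected `X`: the first line of the printed proof, "By Theorem 1.4 in [KW], or more
strongly, by Theorem 4.5.1 in [Gro69], there is a metric `g₁` on `X` with positive scalar
curvature" (p. 7), invokes existence theorems for PSC metrics on manifolds none of whose
components is closed (open manifolds in [Gro69]; `X` embeds in the open manifold `X ∪ ∂X × [0,1)`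
and the metric is restricted), which is legitimate exactly when every component of `X` meets
`∂X`, in particular for connected `X` with `∂X ≠ ∅`, and fails for a closed component such as
`T³`; the rest of the proof
(PSC-cobordism collar of Lemma 2.1 glued along each boundary component, Miao's mollification of
the corner, a boundary-metric-preserving conformal deformation) uses no connectedness. The
mis-statement was found by the discharge seat and flagged in p44436 (docstring-only); the present
rendering (gen 2) RESTATES the fact under the same name with `[ConnectedSpace X]` added and
nothing else changed — the correction endorsed in the p44436 review. The old reading must not be
reintroduced.

## Relation to the route item `FlexBoundaryMetric` (stmt-SmoothPoincare4-8133)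

The item quantifies over ARBITRARY compact 4-manifolds `C` with boundary carrying some PSC metric
(no connectedness). That statement is true, but it is NOT a three-line consequence of the
connected theorem: one applies Thm 1.1 to each component of `C` meeting `∂C`, keeps the given PSC
metric on the closed components, and assembles the metrics over the finitely many clopen
components — the assembly (components of a compact manifold with boundary as compact manifolds
with boundary data, restriction and gluing of smooth metrics, locality of `HasLeviCivita` /
`scalarCurvature`) is not in the tree. The corollary below therefore carries `[ConnectedSpace C]`;
in the route's Assembly the cork `C` is a `ContractibleSpace`, hence connected
(`ContractibleSpace → PathConnectedSpace → ConnectedSpace`), so the connected form is what the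
route uses mathematically; closing item 8133 verbatim needs either the component assembly or a
planner amendment adding `[ConnectedSpace C]`.

## Size of a discharge

XL: the printed proof rests on Gromov's (1969, Thm 4.5.1) / Kazdan–Warner's (Thm 1.4) existence of
PSC metrics on connected manifolds with non-empty boundary, the parabolic quasi-spherical
equation of Lemma 2.1 (Claims 2.1–2.2: scalar curvature of `u² dt² + γ_t`, short-time existence,
sub/super-solution bounds `½e^{-M}ε ≤ u ≤ e^{M}ε`, parabolic regularity), Miao's corner
mollification [Miao02] and an elliptic boundary-preserving conformal deformation — none of which
is in Mathlib or `Literature/` (the tree's only curvature computation of a curved metric is the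
round sphere, `RoundSphereProofs.lean`).

## Progress in the tree (bottom-up, sibling files; everything there is PROVED, no named facts)

* `BoundaryMetricExtensionProofs.lean` — step (1) of the printed proof ("we may assume `γ₁ > γ`
  after a suitable rescaling"): uniform comparability of two metrics on a compact manifold
  (`exists_val_le_mul_val`, `exists_val_lt_mul_val`), the boundary inclusion is a spacelike
  immersion (`isSpacelikeImmersion_incl`), and `ShiWangWei2022_rescaling_step` (a constant
  multiple `c g₁` of a PSC metric is PSC with `incl^*(c g₁) > γ`).
* `MetricLinePath.lean` — the path `γ_t = (1 - t) γ₀ + t γ₁` of the proof of Lemma 2.1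
  (`PseudoRiemannianMetric.conicComb`, `.linePath`: Riemannian, endpoints, affine, monotone).
* `BoundaryMetricExtensionCollar.lean` — the objects of Claim 2.1: `dt²` on `[x, y]`
  (`intervalMetric`), the quasi-spherical cylinder metric `u² dt² + γ_t` on `Σ × [0, 1]`
  (`lapseCylinderMetric`, product model `I_Σ.prod (𝓡∂ 1)`), its slices (`cylinderSlice`; induced
  form `γ_t`, boundary slices `γ₀`, `γ₁` = Def. 2.1 (2) for the metrics).
* `BoundaryMetricExtensionSlices.lean` — the slices as spacelike hypersurfaces with unit normal
  `ν = u⁻¹ ∂_t` (`isSpacelikeImmersion_cylinderSlice`, `inducedMetric_cylinderSlice`,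
  `cylinderSliceNormal`, `isUnitNormal_cylinderSliceNormal`).
* `BoundaryMetricExtensionODE.lean` — the one-variable half of the proof of Claim 2.2: the
  explicit barriers `v`, `w`, their ODEs, `(1+ε²)e^{-Mt} − ε² ≥ e^{-2M}`, `w ≤ e^{M} ε`,
  `v ≥ ½ e^{-M} ε`.

Still missing (each a theory): step (0) = PSC existence on compact connected manifolds with
non-empty boundary ([KW, Thm 1.4] / [Gro69, Thm 4.5.1]); the curvature identity of Claim 2.1
(Levi-Civita connection and second fundamental form of the slices of `u² dt² + γ_t`, traced Gauss
equation — cf. `Lorentzian/GaussEquationFrame.lean` — and the variation of `H` — cf.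
`Lorentzian/IMCFMeanCurvatureEvolution.lean`, surfaces in `3`-manifolds) with the parabolic
existence/comparison of Claim 2.2 (or an ODE variant with constant lapse and reparametrised `t`);
step (3) = Miao's mollification of the corner plus the boundary-metric-preserving conformal
deformation (an elliptic Dirichlet problem); step (4) = transport to `X` (collar uniqueness; the
tree's `Topology/FourManifolds/CylinderCobordism.lean`, `CollarTheoremGeneral.lean` are the
starting points).

## Source

* Y. Shi, W. Wang, G. Wei, *Total mean curvature of the boundary and nonnegative scalar
  curvature fill-ins*, J. reine angew. Math. 784 (2022) 215–250, doi:10.1515/crelle-2021-0072,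
  arXiv:2007.06756 — READ: §1 Question 1.1 and Theorem 1.1 (p. 2 of the arXiv text, quoted
  above), §2 Definition 2.1 (PSC-cobordism of Bartnik data), Lemma 2.1 and its proof
  (quasi-spherical metric `g = u² dt² + γ_t` on `Σ × [0,1]`, Claims 2.1–2.2, pp. 6–7), proof of
  Thm 1.1 (p. 7: Kazdan–Warner Thm 1.4 / Gromov 1969 Thm 4.5.1 give a PSC metric `g₁` on `X`;
  rescale so that `γ₁ = g₁|_Y > γ`; glue the PSC-cobordism from `(Y, γ, h₀)` to `(Y, γ₁, h₁)`,
  `h₁ > -h`; Miao's mollification of the corner and a boundary-metric-preserving conformal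
  deformation; "When `Y` has multiple connected components … we construct PSC-cobordism for every
  component"), Remark 2.1 and Example 2.1 (p. 7).

## Wording risks

* Connectedness: see above — `[ConnectedSpace X]` renders the paper's standing convention; the
  maximal reading of the printed proof ("every component of `X` meets `∂X`") is not vendored.
* Dimension: the paper works with boundaries `Σⁿ`, `n ≥ 2` (Def. 1.1 ff.), i.e. `dim X ≥ 3`; the
  fact is stated for `dim X = m + 3`. Smooth (`C^∞`) compact manifolds with boundary, Hausdorff and
  second countable.
* "Metric on `Y`": a smooth Riemannian metric on the abstract boundary manifold `bX.carrier`;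
  "extended": the pullback of `g` along the boundary inclusion is `γ`.
* The Levi-Civita connection is data in the tree (`HasLeviCivita`, a class); its existence for a
  smooth metric is the fundamental theorem of Riemannian geometry, so `∃ _ : g.HasLeviCivita`
  adds nothing to the printed statement. In the tree's semantics the conclusion really is
  positivity of the scalar curvature: for a smooth metric the Koszul representation and
  curvature-tensoriality conditions behind `leviCivitaFun` / `CovariantDerivative.curvature`
  hold, so no junk value intervenes (and the junk value `0` could not satisfy `0 < S` anyway).
-/

noncomputable section

open scoped Manifold ContDiff
open Literature.Topology.FourManifolds Literature.Geometry.Lorentzian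

namespace Literature.Geometry.Riemannian

universe u

/-- **Shi–Wang–Wei 2022, Thm 1.1 — every boundary metric extends to a PSC metric inside**: "Let
`X` be a compact manifold with non-empty boundary `Y = ∂X`. Then any metric `γ` on `Y` can be
extended to a Riemannian metric `g` on `X` with positive scalar curvature." Here `X` is CONNECTED
(the paper's standing convention, used in the first line of its proof via [KW, Thm 1.4] /
[Gro69, Thm 4.5.1]; without it the statement is false, e.g. `X = T³ ⊔ 𝔻³`, see the module
docstring — this is the gen-2 restatement of 2026-08-15, which adds exactly `[ConnectedSpace X]`
to the gen-1 rendering). Rendered for compact connected smooth `(m+3)`-manifolds with boundary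
(`m : ℕ`; the paper's `dim ≥ 3`), boundary datum `bX` with `bX.carrier` non-empty, `γ` a smooth
Riemannian metric on `bX.carrier`: there is a smooth Riemannian metric `g` on `X`, with its
Levi-Civita connection, of everywhere positive scalar curvature, whose pullback along the
boundary inclusion is `γ`. Answers Gromov's Question (Four lectures, pp. 31–32).
[cite: ShiWangWei2022, Thm. 1.1] -/
def ShiWangWei2022_boundaryMetric_extends_psc : Prop :=
  ∀ (m : ℕ) (X : Type u) [TopologicalSpace X] [T2Space X] [SecondCountableTopology X]
    [ChartedSpace (EuclideanHalfSpace (m + 3)) X] [IsManifold (𝓡∂ (m + 3)) ∞ X] [CompactSpace X]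
    [ConnectedSpace X]
    (bX : BoundaryData (𝓡∂ (m + 3)) X (𝓡 (m + 2))), Nonempty bX.carrier →
    ∀ (γ : PseudoRiemannianMetric (𝓡 (m + 2)) ∞ (EuclideanSpace ℝ (Fin (m + 2)))
      (TangentSpace (𝓡 (m + 2)) : bX.carrier → Type _)), γ.IsRiemannian →
    ∃ g : PseudoRiemannianMetric (𝓡∂ (m + 3)) ∞ (EuclideanSpace ℝ (Fin (m + 3)))
      (TangentSpace (𝓡∂ (m + 3)) : X → Type _), ∃ _ : g.HasLeviCivita,
      g.IsRiemannian ∧ (∀ x, 0 < g.scalarCurvature x) ∧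
        ∀ z, pullbackBilin (I := 𝓡∂ (m + 3)) (I' := 𝓡 (m + 2)) bX.incl g.val z = γ.val z

/-- **Dimension 4, connected, in the form used by route SmoothPoincare4/PscCorkFillIn** (PROVED
from the fact; the statement of item `FlexBoundaryMetric` = `stmt-SmoothPoincare4-8133` with
`[ConnectedSpace C]` ADDED — the item's arbitrary-`C` form needs a component-wise assembly of
metrics that is not in the tree, see the module docstring; the route's cork `C` is contractible,
hence connected): on a compact connected smooth 4-manifold with boundary which admits some
Riemannian metric of positive scalar curvature, every Riemannian metric on the boundary is the
induced boundary form of a Riemannian PSC metric. If the boundary is empty the assumed metric does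
it (the boundary condition is vacuous); otherwise this is Shi–Wang–Wei's theorem with `m = 1`.
[cite: ShiWangWei2022, Thm. 1.1] -/
theorem ShiWangWei2022_boundaryMetric_extends_psc.flexBoundaryMetric_four
    (hSWW : ShiWangWei2022_boundaryMetric_extends_psc.{0}) :
    ∀ (C : Type) [TopologicalSpace C] [T2Space C] [SecondCountableTopology C]
      [ChartedSpace (EuclideanHalfSpace 4) C] [IsManifold (𝓡∂ 4) ∞ C] [CompactSpace C]
      [ConnectedSpace C] (bC : BoundaryData (𝓡∂ 4) C (𝓡 3)),
      (∃ g : PseudoRiemannianMetric (𝓡∂ 4) ∞ (EuclideanSpace ℝ (Fin 4))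
        (TangentSpace (𝓡∂ 4) : C → Type _), ∃ _ : g.HasLeviCivita,
        g.IsRiemannian ∧ ∀ x, 0 < g.scalarCurvature x) →
      ∀ (h : PseudoRiemannianMetric (𝓡 3) ∞ (EuclideanSpace ℝ (Fin 3))
        (TangentSpace (𝓡 3) : bC.carrier → Type _)), h.IsRiemannian →
      ∃ g : PseudoRiemannianMetric (𝓡∂ 4) ∞ (EuclideanSpace ℝ (Fin 4))
        (TangentSpace (𝓡∂ 4) : C → Type _), ∃ _ : g.HasLeviCivita,
        g.IsRiemannian ∧ (∀ x, 0 < g.scalarCurvature x) ∧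
          ∀ z, pullbackBilin (I := 𝓡∂ 4) (I' := 𝓡 3) bC.incl g.val z = h.val z := by
  intro C _ _ _ _ _ _ _ bC hpsc h hh
  rcases isEmpty_or_nonempty bC.carrier with he | hne
  · obtain ⟨g, hLC, hR, hS⟩ := hpsc
    exact ⟨g, hLC, hR, hS, fun z => he.elim z⟩
  · exact hSWW 1 C bC hne h hh

end Literature.Geometry.Riemannian

end
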